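import Summits.Ventures.LatticeQCDFlow.Exactness.IMHMultiProposalPoolEstimator
import HarnessLib

/-!
# The batch read-out is never noisier than one exact sample: at equilibrium `E[(A_f − π f)²] ≤ Var_π f` for the pool-weighted average
# `A_f = Σ_j w(z_j) f(z_j)/Σ_i w(z_i)` of the multi-proposal flow sampler, every positive weight

HONEST FRAMING: exact (Metropolis-corrected) sampling algorithms for lattice gauge theory;
figures of merit are autocorrelation/cost numbers at stated couplings and volumes; no
continuum-physics claim.

Venture `LatticeQCDFlow` (cell pub-lqcd), topic `Exactness`; FANOUT row 30 (lean-1, GEN-41).  NEW WORK of the cell, sequel of GEN-41's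
`IMHMultiProposalPoolEstimator` (at equilibrium, `x ∼ π`, `y ∼ q^{⊗n}`, the pool-weighted read-out over `z = (x, y_1, …, y_n)` has mean exactly
`π f`).  Here the REAL-VALUED read-out `A_f(z) = Σ_j w(z_j) f(z_j)/W(z)` (`W = Σ_i w(z_i) > 0`) and its second moment: conditionally on the pool
`A_f` is the mean of `f` at the selected member, so by Jensen its squared deviation from any constant is at most the pool-weighted squared
deviation, whose mean is the target's — the Rao–Blackwell inequality of the "use-all-proposals" estimator.

* §1 (pointwise) `poolAvg_sub_const` (`A_f − θ = A_{f−θ}`: the pool weights sum to one), **`poolAvg_sq_le`** (`A_g² ≤ A_{g²}`, finite Jensen,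
  Mathlib's `ConvexOn.map_sum_le`), `ofReal_poolAvg_eq` (the `ℝ≥0∞` pool average of GEN-41's file is `ofReal ∘ A_g` for `g ≥ 0`),
  `measurable_poolAvg`, `poolAvg_mem_Icc`.
* §2 **`multiProposal_poolAvg_integral_eq`** — `∫∫ A_g(x ∷ y) dq^{⊗n} dπ = ∫ g dπ` for measurable `0 ≤ g ≤ c`, in real (Bochner) form.
* §3 **`multiProposal_poolAvg_sq_sub_le`** — for measurable `0 ≤ f ≤ c` and every constant `θ`:
  `∫∫ (A_f(x ∷ y) − θ)² dq^{⊗n} dπ ≤ ∫ (f − θ)² dπ`; at `θ = π f` the right side is `Var_π f`: THE BATCH READ-OUT IS NEVER NOISIER THAN ONE EXACT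
  SAMPLE, and it is unbiased (`IMHMultiProposalPoolEstimator`).
NOT CLAIMED: the size of the variance REDUCTION (it depends on the flow); anything off equilibrium (see `IMHMultiProposalPoolReadoutBias`);
time averages.  No `sorry`, no new definitions, nothing cited as a fact.
-/

noncomputable section

namespace Summit.Ventures.LatticeQCDFlow.Exactness

open MeasureTheory ProbabilityTheory Function Finset
open scoped ENNReal

variable {Ω : Type*} [MeasurableSpace Ω] {q : Measure Ω} [IsProbabilityMeasure q] {w : Ω → ℝ} {n : ℕ}

/-! ## §1 Pointwise facts about the real pool average -/

omit [MeasurableSpace Ω] in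
/-- The pool weight is positive for a positive weight. [ours, bookkeeping] -/
theorem sum_weight_real_pos (hw0 : ∀ y, 0 < w y) (z : Fin (n + 1) → Ω) : 0 < ∑ i, w (z i) :=
  Finset.sum_pos (fun _ _ => hw0 _) Finset.univ_nonempty

omit [MeasurableSpace Ω] in
/-- **`A_f − θ = A_{f − θ}`**: the pool weights sum to one. [ours, bookkeeping] -/
theorem poolAvg_sub_const (hw0 : ∀ y, 0 < w y) (f : Ω → ℝ) (θ : ℝ) (z : Fin (n + 1) → Ω) :
    (∑ j, w (z j) * f (z j)) / (∑ i, w (z i)) - θ = (∑ j, w (z j) * (f (z j) - θ)) / ∑ i, w (z i) := by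
  have hW := (sum_weight_real_pos hw0 z).ne'
  rw [eq_div_iff hW, sub_mul, div_mul_cancel₀ _ hW, Finset.mul_sum, ← Finset.sum_sub_distrib]
  exact Finset.sum_congr rfl fun j _ => by ring

omit [MeasurableSpace Ω] in
/-- **FINITE JENSEN: `A_g² ≤ A_{g²}`.** [ours] -/
theorem poolAvg_sq_le (hw0 : ∀ y, 0 < w y) (g : Ω → ℝ) (z : Fin (n + 1) → Ω) :
    ((∑ j, w (z j) * g (z j)) / ∑ i, w (z i)) ^ 2 ≤ (∑ j, w (z j) * g (z j) ^ 2) / ∑ i, w (z i) := by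
  have hW := sum_weight_real_pos hw0 z
  set p : Fin (n + 1) → ℝ := fun j => w (z j) / ∑ i, w (z i) with hp
  have hp0 : ∀ j ∈ Finset.univ, 0 ≤ p j := fun j _ => div_nonneg (hw0 _).le hW.le
  have hp1 : ∑ j, p j = 1 := by rw [hp]; simp only; rw [← Finset.sum_div, div_self hW.ne']
  have hJ := (Even.convexOn_pow (n := 2) even_two).map_sum_le (t := Finset.univ) (w := p) (p := fun j => g (z j)) hp0 hp1
    (fun j _ => Set.mem_univ _)
  simp only [smul_eq_mul] at hJ
  have hL : ∑ j, p j * g (z j) = (∑ j, w (z j) * g (z j)) / ∑ i, w (z i) := by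
    simp only [hp, div_mul_eq_mul_div, Finset.sum_div]
  have hR : ∑ j, p j * g (z j) ^ 2 = (∑ j, w (z j) * g (z j) ^ 2) / ∑ i, w (z i) := by
    simp only [hp, div_mul_eq_mul_div, Finset.sum_div]
  rw [← hL, ← hR]; exact hJ

omit [MeasurableSpace Ω] in
/-- **The `ℝ≥0∞` pool average is `ofReal` of the real one** for `g ≥ 0`. [ours, bookkeeping] -/
theorem ofReal_poolAvg_eq (hw0 : ∀ y, 0 < w y) {g : Ω → ℝ} (hg0 : ∀ y, 0 ≤ g y) (z : Fin (n + 1) → Ω) :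
    ENNReal.ofReal ((∑ j, w (z j) * g (z j)) / ∑ i, w (z i)) =
      (∑ j, ENNReal.ofReal (w (z j)) * ENNReal.ofReal (g (z j))) / ∑ i, ENNReal.ofReal (w (z i)) := by
  rw [ENNReal.ofReal_div_of_pos (sum_weight_real_pos hw0 z), ENNReal.ofReal_sum_of_nonneg (fun i _ => (hw0 _).le),
    ENNReal.ofReal_sum_of_nonneg (fun i _ => mul_nonneg (hw0 _).le (hg0 _))]
  congr 1
  exact Finset.sum_congr rfl fun i _ => ENNReal.ofReal_mul (hw0 _).le

/-- Measurability of the real pool average. [ours, bookkeeping] -/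
theorem measurable_poolAvg (hw : Measurable w) {g : Ω → ℝ} (hg : Measurable g) :
    Measurable fun z : Fin (n + 1) → Ω => (∑ j, w (z j) * g (z j)) / ∑ i, w (z i) :=
  (Finset.measurable_sum _ fun j _ => (hw.comp (measurable_pi_apply j)).mul (hg.comp (measurable_pi_apply j))).div
    (Finset.measurable_sum _ fun i _ => hw.comp (measurable_pi_apply i))

omit [MeasurableSpace Ω] in
/-- The pool average of `g ∈ [a, c]` lies in `[a, c]`. [ours, bookkeeping] -/
theorem poolAvg_mem_Icc (hw0 : ∀ y, 0 < w y) {g : Ω → ℝ} {a c : ℝ} (ha : ∀ y, a ≤ g y) (hc : ∀ y, g y ≤ c) (z : Fin (n + 1) → Ω) :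
    (∑ j, w (z j) * g (z j)) / (∑ i, w (z i)) ∈ Set.Icc a c := by
  have hW := sum_weight_real_pos hw0 z
  constructor
  · rw [le_div_iff₀ hW, Finset.mul_sum]
    exact Finset.sum_le_sum fun j _ => by rw [mul_comm a]; exact mul_le_mul_of_nonneg_left (ha _) (hw0 _).le
  · rw [div_le_iff₀ hW, Finset.mul_sum]
    exact Finset.sum_le_sum fun j _ => by rw [mul_comm c]; exact mul_le_mul_of_nonneg_left (hc _) (hw0 _).le

/-! ## §2 The real form of the unbiasedness -/

/-- **`∫∫ A_g(x ∷ y) dq^{⊗n} dπ = ∫ g dπ`** for measurable `0 ≤ g ≤ c` and a positive measurable weight (Bochner form). [ours] -/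
theorem multiProposal_poolAvg_integral_eq (hw : Measurable w) (hw0 : ∀ y, 0 < w y) [IsProbabilityMeasure (q.withDensity fun x => ENNReal.ofReal (w x))]
    {g : Ω → ℝ} (hg : Measurable g) (hg0 : ∀ y, 0 ≤ g y) {c : ℝ} (hgc : ∀ y, g y ≤ c) :
    ∫ x, ∫ y, (∑ j, w (Fin.cons (α := fun _ : Fin (n + 1) => Ω) x y j) * g (Fin.cons (α := fun _ : Fin (n + 1) => Ω) x y j)) /
        (∑ i, w (Fin.cons (α := fun _ : Fin (n + 1) => Ω) x y i)) ∂(Measure.pi fun _ : Fin n => q) ∂(q.withDensity fun x => ENNReal.ofReal (w x)) =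
      ∫ x, g x ∂(q.withDensity fun x => ENNReal.ofReal (w x)) := by
  rw [← multiProposal_poolAverage_integral_eq (n := n) hw hw0 hg hg0 hgc]
  refine integral_congr_ae (ae_of_all _ fun x => ?_)
  have hAm : Measurable fun y : Fin n → Ω => (∑ j, w (Fin.cons (α := fun _ : Fin (n + 1) => Ω) x y j) *
      g (Fin.cons (α := fun _ : Fin (n + 1) => Ω) x y j)) / ∑ i, w (Fin.cons (α := fun _ : Fin (n + 1) => Ω) x y i) :=
    (measurable_cons_comp (measurable_poolAvg hw hg)).comp (measurable_const.prodMk measurable_id)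
  simp only
  rw [integral_eq_lintegral_of_nonneg_ae (ae_of_all _ fun y => (poolAvg_mem_Icc hw0 hg0 hgc _).1) hAm.aestronglyMeasurable]
  congr 1
  exact lintegral_congr fun y => ofReal_poolAvg_eq hw0 hg0 _

/-! ## §3 The second moment: never noisier than one exact sample -/

/-- **`∫∫ (A_f(x ∷ y) − θ)² dq^{⊗n} dπ ≤ ∫ (f − θ)² dπ`** at equilibrium, for measurable `0 ≤ f ≤ c`, every constant `θ` and every positive
measurable weight; at `θ = π f` the right side is `Var_π f`. [ours] -/
theorem multiProposal_poolAvg_sq_sub_le (hw : Measurable w) (hw0 : ∀ y, 0 < w y) [IsProbabilityMeasure (q.withDensity fun x => ENNReal.ofReal (w x))]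
    {f : Ω → ℝ} (hf : Measurable f) (hf0 : ∀ y, 0 ≤ f y) {c : ℝ} (hfc : ∀ y, f y ≤ c) (θ : ℝ) :
    ∫ x, ∫ y, ((∑ j, w (Fin.cons (α := fun _ : Fin (n + 1) => Ω) x y j) * f (Fin.cons (α := fun _ : Fin (n + 1) => Ω) x y j)) /
        (∑ i, w (Fin.cons (α := fun _ : Fin (n + 1) => Ω) x y i)) - θ) ^ 2 ∂(Measure.pi fun _ : Fin n => q)
        ∂(q.withDensity fun x => ENNReal.ofReal (w x)) ≤
      ∫ x, (f x - θ) ^ 2 ∂(q.withDensity fun x => ENNReal.ofReal (w x)) := by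
  set π : Measure Ω := q.withDensity fun x => ENNReal.ofReal (w x) with hπ
  set pin : Measure (Fin n → Ω) := Measure.pi fun _ : Fin n => q with hpin
  set g : Ω → ℝ := fun y => (f y - θ) ^ 2 with hgdef
  have hc0 : 0 ≤ c := by obtain ⟨y⟩ := nonempty_of_isProbabilityMeasure q; exact (hf0 y).trans (hfc y)
  -- `g = (f − θ)² ∈ [0, C]` with `C = max(θ², (c − θ)²)`
  set C : ℝ := max (θ ^ 2) ((c - θ) ^ 2) with hC
  have hg : Measurable g := (hf.sub_const θ).pow_const 2
  have hg0 : ∀ y, 0 ≤ g y := fun y => sq_nonneg _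
  have hgC : ∀ y, g y ≤ C := fun y => by
    rw [hgdef]
    rcases le_total (f y) θ with h | h
    · calc (f y - θ) ^ 2 = (θ - f y) ^ 2 := by ring
        _ ≤ θ ^ 2 := pow_le_pow_left₀ (by linarith) (by linarith [hf0 y]) 2
        _ ≤ C := le_max_left _ _
    · calc (f y - θ) ^ 2 ≤ (c - θ) ^ 2 := pow_le_pow_left₀ (by linarith) (by linarith [hfc y]) 2
        _ ≤ C := le_max_right _ _
  -- pointwise Jensen on each pool
  have hpt : ∀ z : Fin (n + 1) → Ω, ((∑ j, w (z j) * f (z j)) / (∑ i, w (z i)) - θ) ^ 2 ≤ (∑ j, w (z j) * g (z j)) / ∑ i, w (z i) :=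
    fun z => by rw [poolAvg_sub_const hw0 f θ z]; exact poolAvg_sq_le hw0 (fun y => f y - θ) z
  -- integrate in `y`, then in `x`
  have hinner : ∀ x, ∫ y, ((∑ j, w (Fin.cons (α := fun _ : Fin (n + 1) => Ω) x y j) * f (Fin.cons (α := fun _ : Fin (n + 1) => Ω) x y j)) /
        (∑ i, w (Fin.cons (α := fun _ : Fin (n + 1) => Ω) x y i)) - θ) ^ 2 ∂pin ≤
      ∫ y, (∑ j, w (Fin.cons (α := fun _ : Fin (n + 1) => Ω) x y j) * g (Fin.cons (α := fun _ : Fin (n + 1) => Ω) x y j)) /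
        (∑ i, w (Fin.cons (α := fun _ : Fin (n + 1) => Ω) x y i)) ∂pin := fun x => by
    have hGm : Measurable fun y : Fin n → Ω => (∑ j, w (Fin.cons (α := fun _ : Fin (n + 1) => Ω) x y j) *
        g (Fin.cons (α := fun _ : Fin (n + 1) => Ω) x y j)) / ∑ i, w (Fin.cons (α := fun _ : Fin (n + 1) => Ω) x y i) :=
      (measurable_cons_comp (measurable_poolAvg hw hg)).comp (measurable_const.prodMk measurable_id)
    refine integral_mono_of_nonneg (ae_of_all _ fun y => sq_nonneg _) ?_ (ae_of_all _ fun y => hpt _)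
    exact Integrable.of_bound hGm.aestronglyMeasurable C (ae_of_all _ fun y => by
      rw [Real.norm_eq_abs, abs_of_nonneg (poolAvg_mem_Icc hw0 hg0 hgC _).1]; exact (poolAvg_mem_Icc hw0 hg0 hgC _).2)
  have houter_m : Measurable fun x => ∫ y, (∑ j, w (Fin.cons (α := fun _ : Fin (n + 1) => Ω) x y j) *
        g (Fin.cons (α := fun _ : Fin (n + 1) => Ω) x y j)) / (∑ i, w (Fin.cons (α := fun _ : Fin (n + 1) => Ω) x y i)) ∂pin := by
    have hm := measurable_cons_comp (n := n) (measurable_poolAvg hw hg)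
    exact (hm.stronglyMeasurable.integral_prod_right' : StronglyMeasurable _).measurable
  calc ∫ x, ∫ y, ((∑ j, w (Fin.cons (α := fun _ : Fin (n + 1) => Ω) x y j) * f (Fin.cons (α := fun _ : Fin (n + 1) => Ω) x y j)) /
        (∑ i, w (Fin.cons (α := fun _ : Fin (n + 1) => Ω) x y i)) - θ) ^ 2 ∂pin ∂π
      ≤ ∫ x, ∫ y, (∑ j, w (Fin.cons (α := fun _ : Fin (n + 1) => Ω) x y j) * g (Fin.cons (α := fun _ : Fin (n + 1) => Ω) x y j)) /
        (∑ i, w (Fin.cons (α := fun _ : Fin (n + 1) => Ω) x y i)) ∂pin ∂π := by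
        refine integral_mono_of_nonneg (ae_of_all _ fun x => integral_nonneg fun y => sq_nonneg _) ?_ (ae_of_all _ hinner)
        exact Integrable.of_bound houter_m.aestronglyMeasurable C (ae_of_all _ fun x => by
          rw [Real.norm_eq_abs, abs_of_nonneg (integral_nonneg fun y => (poolAvg_mem_Icc hw0 hg0 hgC _).1)]
          calc ∫ y, (∑ j, w (Fin.cons (α := fun _ : Fin (n + 1) => Ω) x y j) * g (Fin.cons (α := fun _ : Fin (n + 1) => Ω) x y j)) /
                (∑ i, w (Fin.cons (α := fun _ : Fin (n + 1) => Ω) x y i)) ∂pin ≤ ∫ _, C ∂pin :=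
                integral_mono_of_nonneg (ae_of_all _ fun y => (poolAvg_mem_Icc hw0 hg0 hgC _).1) (integrable_const C)
                  (ae_of_all _ fun y => (poolAvg_mem_Icc hw0 hg0 hgC _).2)
            _ = C := by simp)
    _ = ∫ x, g x ∂π := multiProposal_poolAvg_integral_eq hw hw0 hg hg0 hgC

end Summit.Ventures.LatticeQCDFlow.Exactness
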